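import Summits.NavierStokesRegularity.NavierStokesRegularity.Theses.ExtremiserTransience
import Summits.NavierStokesRegularity.NavierStokesRegularity.Theorems.ExtremiserTransienceNearExtremalTransienceDSSLogMean
import Summits.NavierStokesRegularity.NavierStokesRegularity.Theorems.ExtremiserTransienceNearExtremalTransienceSharpConstant
import Summits.NavierStokesRegularity.NavierStokesRegularity.Theorems.ExtremiserTransiencePlateauSliceRigidity
import Summits.NavierStokesRegularity.NavierStokesRegularity.Theorems.ExtremiserTransienceNearExtremalTransienceExtremiserLiouvillePlateau
import Summits.NavierStokesRegularity.NavierStokesRegularity.Theorems.PoloidalWindowDoorPoloidalWindowRigidityTypeIAnalytic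
import Literature.Analysis.FluidPDE.BlowupAncientSolution
import Literature.Analysis.FluidPDE.NSBoundedMildOseen
import Literature.Analysis.FluidPDE.MildSolution
import HarnessLib.Audit

/-!
# Crux `ExtremiserTransience.NearExtremalTransience` (stmt-NavierStokesRegularity-21883) — LINE «type_one_splice»
# (ideator seat ns-idea-10, generation 7, lens «rescuer»; files-only line, no registry writes)

RECORDED DEATH DODGED.  Line B (`Lines/extremiser_liouville.lean`) proves the crux from K2 (persistence ⇒ an extremal KNSS
ancient solution) and K1 = K1a (analytic slices) + K1b (no analytic extremal field).  K1b has turned into a long static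
march (the K1b residue: constant speed, multiplier measure, FLAT/JET dichotomy, N8′/N9′; > 60 tree files; our own LINE
«kernel_budget» is one more plan for it).  THE DODGE: the flows of the crux are TYPE I, and the Type-I rate SURVIVES the
KNSS zoom whenever the witnesses' rates are bounded: the limit then lies in the weak one-slice class of item 27823, where the
TREE already proves (`plateauSliceRigidity`, p641514: subcubic local energy budget `∫_{B_ρ}‖W t‖² ≤ C(K)ρ²/√(−t)`) that NO
slice has an exact speed plateau of positive volume — while EVERY analytic extremal slice has a GLOBAL plateau
(`ExtremiserLiouville.norm_eq_of_analytic_extremal`, ns-el-k1b) and Type-I mild slices ARE analytic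
(`typeI_mild_slice_analytic`).  Hence `noExtremalAncient_of_typeI` below is a THEOREM (no sorry): there is no
Type-I-decaying extremal ancient solution.  K1a and K1b are thereby DISCHARGED on the bounded-rate sector; what the
universal crux still owes is isolated as ONE explicit residual, `stub_rateInheritance` (the universal θ of 21883 is uniform
in the Type-I constant C, so persistence witnesses may have C → ∞ — «wild-rate persistence»; the per-flow branch 26567 has C
fixed and owes nothing here).

STUBS (2) and composition (kernel-checked; sorries only inside the two stubs):
* `stub_rateInheritance` (R, residual of the UNIVERSAL formulation): persistence P ⇒ persistence witnessed at bounded Type-I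
  rate (P_dec).  No mechanism known; implied by ¬P (so by any closing of line B); it is exactly where 21883 exceeds C-wise
  statements.  LOGICAL DISCLOSURE: since `noExtremalAncient_of_typeI` is proved, stub K is equivalent to ¬P_dec («bounded-rate
  near-extremal transience»: one θ serving all flows with Type-I constant ≤ C₀ — between the per-flow 26567 and the universal
  21883); its intended proof is line B's K2 extraction by contradiction, with K1 supplied by this file.
* `stub_boundedRateExtremalLimit` (K2 on bounded-rate witnesses, XL — line B's K2 with the decay clause, which is FREE here:
  the KNSS rescaling of a flow with √(T−t)‖u‖ ≤ C√ν has √(−s)‖W s‖ ≤ C′ for s < 0): P_dec ⇒ a Type-I-decaying extremal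
  ancient solution.
* PROVED `noExtremalAncient_of_typeI` : no such object (tree splice, ~40 lines).
* PROVED `NearExtremalTransience_of` : the crux BY NAME (line B's persistence bookkeeping verbatim after `hnotP`).

BY-PRODUCT FOR THE ROUTE (director / ns-idea-5 / ns-el-k1b): item 26569 `NoExtremalAncient` (generic KNSS class, open) is
needlessly strong for the per-flow β-branch — there C is FIXED, the tangent object of 26568/27696 carries the decay clause for
free (as 27677's plateau element already does), and the Type-I variant is `noExtremalAncient_of_typeI` (sorry-free, here).
HONEST FRAMING: nothing here proves K2, the crux, or NS regularity; no summit is proved by a line.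
-/

noncomputable section

open Set MeasureTheory Filter Topology
open scoped InnerProductSpace RealInnerProductSpace ENNReal

namespace Summit.NavierStokesRegularity.NavierStokesRegularity.Cruxes.NearExtremalTransience.TypeOneSplice

open Summit.NavierStokesRegularity.NavierStokesRegularity.Theses.ExtremiserTransience
open Summit.NavierStokesRegularity.NavierStokesRegularity.Theorems
open Summit.NavierStokesRegularity.NavierStokesRegularity.Theorems.DepletionLadder

set_option linter.dupNamespace false
set_option linter.style.longLine false

namespace Sig

/-- `P` — line B's persistence hypothesis (the hypothesis of its K2 `stub_extremalPersistenceCompactness`,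
verbatim): near-extremal efficiency at every level `β < κ⋆²` persists for every log-length `L` on some flow of
the class of the crux (eventual rate `√(T-t)‖u‖ ≤ C√ν`, no smooth extension). Informational name; the
composition restates it inline. -/
def Persistence : Prop :=
    ∀ β : ℝ, β < (sInf {κ : ℝ | (∀ (v : EuclideanSpace ℝ (Fin 3) → EuclideanSpace ℝ (Fin 3)) (M B : ℝ), ContDiff ℝ (⊤ : ℕ∞) v → Literature.Analysis.FluidPDE.VectorCalculus.IsDivFree v → (∀ x, ‖v x‖ ≤ M) → (∀ x, ‖fderiv ℝ v x‖ ≤ B) → (∫⁻ x, ‖iteratedFDeriv ℝ 0 v x‖ₑ ^ 2 < ⊤) → (∫⁻ x, ‖iteratedFDeriv ℝ 1 v x‖ₑ ^ 2 < ⊤) → (∫⁻ x, ‖iteratedFDeriv ℝ 2 v x‖ₑ ^ 2 < ⊤) → |∫ x, ⟪Literature.Analysis.FluidPDE.curl v x, fderiv ℝ v x (Literature.Analysis.FluidPDE.curl v x)⟫_ℝ| ≤ κ * M * Real.sqrt (∫ x, ‖Literature.Analysis.FluidPDE.curl v x‖ ^ 2) * Real.sqrt (∫ x, Literature.Analysis.FluidPDE.frobeniusNormSq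 (fderiv ℝ (Literature.Analysis.FluidPDE.curl v) x)))}) ^ 2 → ∀ L : ℝ, 0 < L → ∃ (C ν T : ℝ) (u : ℝ → EuclideanSpace ℝ (Fin 3) → EuclideanSpace ℝ (Fin 3)) (p : ℝ → EuclideanSpace ℝ (Fin 3) → ℝ), 0 < C ∧ 0 < ν ∧ 0 < T ∧ Literature.Analysis.FluidPDE.IsClassicalNSSolutionOn (Set.Ico 0 T) ν 0 u p ∧ Literature.Analysis.FluidPDE.IsLerayHopfOn T ν 0 (u 0) u ∧ Literature.Analysis.FluidPDE.HasRapidSpatialDecay (u 0) ∧ (∀ᶠ t in 𝓝[<] T, ∀ x, Real.sqrt (T - t) * ‖u t x‖ ≤ C * Real.sqrt ν) ∧ ¬ Literature.Analysis.FluidPDE.HasSmoothExtensionPast ν 0 u T ∧ ∀ (k : ℝ → ℝ), Measurable k → (∀ τ, 0 ≤ k τ ∧ k τ ≤ 1) → (∀ t ∈ Set.Ico 0 T, ∀ M : ℝ, (∀ x, ‖u t x‖ ≤ M) → |∫ x, ⟪Literature.Analysis.FluidPDE.curl (u t) x, fderiv ℝ (u t) x (Literature.Analysis.FluidPDE.curl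 (u t) x)⟫_ℝ| ≤ k t * M * Real.sqrt (∫ x, ‖Literature.Analysis.FluidPDE.curl (u t) x‖ ^ 2) * Real.sqrt (∫ x, Literature.Analysis.FluidPDE.frobeniusNormSq (fderiv ℝ (Literature.Analysis.FluidPDE.curl (u t)) x))) → ∀ t₁ ∈ Set.Ico 0 T, ∃ s₁ s₂ : ℝ, t₁ ≤ s₁ ∧ s₁ < s₂ ∧ s₂ < T ∧ L ≤ Real.log ((T - s₁) / (T - s₂)) ∧ β * Real.log ((T - s₁) / (T - s₂)) < ∫ τ in s₁..s₂, k τ ^ 2 / (T - τ)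

/-- `P_dec` — BOUNDED-RATE persistence: the same, with ONE bound `C₀` on the eventual Type-I constants `C` of
the witnessing flows (uniformly in the level `β` and the log-length `L`). -/
def BoundedRatePersistence : Prop :=
    ∃ C₀ : ℝ, ∀ β : ℝ, β < (sInf {κ : ℝ | (∀ (v : EuclideanSpace ℝ (Fin 3) → EuclideanSpace ℝ (Fin 3)) (M B : ℝ), ContDiff ℝ (⊤ : ℕ∞) v → Literature.Analysis.FluidPDE.VectorCalculus.IsDivFree v → (∀ x, ‖v x‖ ≤ M) → (∀ x, ‖fderiv ℝ v x‖ ≤ B) → (∫⁻ x, ‖iteratedFDeriv ℝ 0 v x‖ₑ ^ 2 < ⊤) → (∫⁻ x, ‖iteratedFDeriv ℝ 1 v x‖ₑ ^ 2 < ⊤) → (∫⁻ x, ‖iteratedFDeriv ℝ 2 v x‖ₑ ^ 2 < ⊤) → |∫ x, ⟪Literature.Analysis.FluidPDE.curl v x, fderiv ℝ v x (Literature.Analysis.FluidPDE.curl v x)⟫_ℝ| ≤ κ * M * Real.sqrt (∫ x, ‖Literature.Analysis.FluidPDE.curl v x‖ ^ 2) * Real.sqrt (∫ x, Literature.Analysis.FluidPDE.frobeniusNormSq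 (fderiv ℝ (Literature.Analysis.FluidPDE.curl v) x)))}) ^ 2 → ∀ L : ℝ, 0 < L → ∃ (C ν T : ℝ) (u : ℝ → EuclideanSpace ℝ (Fin 3) → EuclideanSpace ℝ (Fin 3)) (p : ℝ → EuclideanSpace ℝ (Fin 3) → ℝ), C ≤ C₀ ∧ 0 < C ∧ 0 < ν ∧ 0 < T ∧ Literature.Analysis.FluidPDE.IsClassicalNSSolutionOn (Set.Ico 0 T) ν 0 u p ∧ Literature.Analysis.FluidPDE.IsLerayHopfOn T ν 0 (u 0) u ∧ Literature.Analysis.FluidPDE.HasRapidSpatialDecay (u 0) ∧ (∀ᶠ t in 𝓝[<] T, ∀ x, Real.sqrt (T - t) * ‖u t x‖ ≤ C * Real.sqrt ν) ∧ ¬ Literature.Analysis.FluidPDE.HasSmoothExtensionPast ν 0 u T ∧ ∀ (k : ℝ → ℝ), Measurable k → (∀ τ, 0 ≤ k τ ∧ k τ ≤ 1) → (∀ t ∈ Set.Ico 0 T, ∀ M : ℝ, (∀ x, ‖u t x‖ ≤ M) → |∫ x, ⟪Literature.Analysis.FluidPDE.curl (u t) x, fderiv ℝ (u t) x (Literature.Analysis.FluidPDE.curl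 (u t) x)⟫_ℝ| ≤ k t * M * Real.sqrt (∫ x, ‖Literature.Analysis.FluidPDE.curl (u t) x‖ ^ 2) * Real.sqrt (∫ x, Literature.Analysis.FluidPDE.frobeniusNormSq (fderiv ℝ (Literature.Analysis.FluidPDE.curl (u t)) x))) → ∀ t₁ ∈ Set.Ico 0 T, ∃ s₁ s₂ : ℝ, t₁ ≤ s₁ ∧ s₁ < s₂ ∧ s₂ < T ∧ L ≤ Real.log ((T - s₁) / (T - s₂)) ∧ β * Real.log ((T - s₁) / (T - s₂)) < ∫ τ in s₁..s₂, k τ ^ 2 / (T - τ)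

/-- `Ext_I` — an extremal KNSS ancient mild solution WITH a Type-I time-decay bound
`√(-t)‖W t x‖ ≤ K` (line B's extremal-limit object + the inherited rate). REFUTED below, sorry-free
(`noExtremalAncient_of_typeI`). -/
def ExtremalTypeIAncient : Prop :=
    ∃ (W : ℝ → EuclideanSpace ℝ (Fin 3) → EuclideanSpace ℝ (Fin 3)) (a b K : ℝ), (Literature.Analysis.FluidPDE.IsKNSSBlowupLimit W ∧ (∀ s t : ℝ, s < t → t < 0 → ∀ x, W t x = Literature.Analysis.FluidPDE.heatFlow (W s) (t - s) x - Literature.Analysis.FluidPDE.oseenDuhamel 1 s W W t x)) ∧ (∀ t : ℝ, t < 0 → ∀ x, Real.sqrt (-t) * ‖W t x‖ ≤ K) ∧ a < b ∧ b ≤ 0 ∧ ∀ᵐ t : ℝ, t ∈ Set.Ioo a b → (ContDiff ℝ (⊤ : ℕ∞) (W t) ∧ Literature.Analysis.FluidPDE.VectorCalculus.IsDivFree (W t) ∧ (∃ B : ℝ, ∀ x, ‖fderiv ℝ (W t) x‖ ≤ B) ∧ (∫⁻ x, ‖iteratedFDeriv ℝ 1 (W t) x‖ₑ ^ 2 < ⊤)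 ∧ (∫⁻ x, ‖iteratedFDeriv ℝ 2 (W t) x‖ₑ ^ 2 < ⊤) ∧ ∃ M : ℝ, (∀ x, ‖(W t) x‖ ≤ M) ∧ 0 < M * Real.sqrt (∫ x, ‖Literature.Analysis.FluidPDE.curl (W t) x‖ ^ 2) * Real.sqrt (∫ x, Literature.Analysis.FluidPDE.frobeniusNormSq (fderiv ℝ (Literature.Analysis.FluidPDE.curl (W t)) x)) ∧ (sInf {κ : ℝ | (∀ (v : EuclideanSpace ℝ (Fin 3) → EuclideanSpace ℝ (Fin 3)) (M B : ℝ), ContDiff ℝ (⊤ : ℕ∞) v → Literature.Analysis.FluidPDE.VectorCalculus.IsDivFree v → (∀ x, ‖v x‖ ≤ M) → (∀ x, ‖fderiv ℝ v x‖ ≤ B) → (∫⁻ x, ‖iteratedFDeriv ℝ 0 v x‖ₑ ^ 2 < ⊤) → (∫⁻ x, ‖iteratedFDeriv ℝ 1 v x‖ₑ ^ 2 < ⊤) → (∫⁻ x, ‖iteratedFDeriv ℝ 2 v x‖ₑ ^ 2 < ⊤) → |∫ x, ⟪Literature.Analysis.FluidPDE.curl v x, fderiv ℝ v x (Literature.Analysis.FluidPDE.curl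 v x)⟫_ℝ| ≤ κ * M * Real.sqrt (∫ x, ‖Literature.Analysis.FluidPDE.curl v x‖ ^ 2) * Real.sqrt (∫ x, Literature.Analysis.FluidPDE.frobeniusNormSq (fderiv ℝ (Literature.Analysis.FluidPDE.curl v) x)))}) * M * Real.sqrt (∫ x, ‖Literature.Analysis.FluidPDE.curl (W t) x‖ ^ 2) * Real.sqrt (∫ x, Literature.Analysis.FluidPDE.frobeniusNormSq (fderiv ℝ (Literature.Analysis.FluidPDE.curl (W t)) x)) ≤ |∫ x, ⟪Literature.Analysis.FluidPDE.curl (W t) x, fderiv ℝ (W t) x (Literature.Analysis.FluidPDE.curl (W t) x)⟫_ℝ|)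

/-- Signature of the residual stub R («wild-rate persistence»): persistence ⇒ bounded-rate persistence. -/
def StubR : Prop := Persistence → BoundedRatePersistence

/-- Signature of stub K (line B's K2 on the bounded-rate sector, with the rate carried INTO the limit). -/
def StubK : Prop := BoundedRatePersistence → ExtremalTypeIAncient

end Sig

/-- **stub_rateInheritance (R · residual of the universal formulation).**  Persistence can be witnessed at bounded Type-I rate.
Why it might fail: «wild-rate persistence» — near-extremal windows of growing log-length might exist only in flows whose actual
rate limsup √(T−t)‖u‖/√ν diverges; then 21883 (θ uniform in C) is false while every C-wise / per-flow statement may hold.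
No mechanism is claimed; this stub is what the universal crux costs beyond the bounded-rate sector. [this line] -/
theorem stub_rateInheritance : Sig.StubR := by
  sorry

/-- **stub_boundedRateExtremalLimit (K2 on the bounded-rate sector · dynamic compactness · XL).**  From bounded-rate persistence
extract a KNSS blow-up limit in the Oseen gauge WITH backward Type-I decay whose slices are extremal for a.e. time of an
interval (line B's K2 verbatim plus the decay clause, inherited from √(T−t)‖u‖ ≤ C√ν, C ≤ C₀, under the KNSS rescaling).
Why it might fail: exactly as K2 — near-extremality need not localise at the zoom (crowds, B5-5); the decay clause itself is free.
[KNSS2009 Prop. 6.1; SereginSverak2009; Lines/extremiser_liouville.md K2] -/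
theorem stub_boundedRateExtremalLimit : Sig.StubK := by
  sorry

/-- **PROVED — no Type-I-decaying extremal ancient solution** (the splice).  Pick an extremal time `t < 0`; the slice is analytic
(`typeI_mild_slice_analytic`: Type-I decay + joint continuity + Oseen-mildness), attains the extended sharp inequality
(`ExtremiserLiouville.extendedSharp` gives `≤`, extremality gives `≥`), hence has CONSTANT SPEED `M > 0`
(`ExtremiserLiouville.norm_eq_of_analytic_extremal`), i.e. the plateau `{‖W t‖ = M}` is all of ℝ³ — excluded by the landed
`plateauSliceRigidity` (item 27823, p641514). [tree] -/
theorem noExtremalAncient_of_typeI : ¬ Sig.ExtremalTypeIAncient := by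
  intro hx
  obtain ⟨W, a, b, K, hW, hdec, hab, hb0, hae⟩ := hx
  have hex : ∃ t ∈ Set.Ioo a b, (ContDiff ℝ (⊤ : ℕ∞) (W t) ∧ Literature.Analysis.FluidPDE.VectorCalculus.IsDivFree (W t) ∧ (∃ B : ℝ, ∀ x, ‖fderiv ℝ (W t) x‖ ≤ B) ∧ (∫⁻ x, ‖iteratedFDeriv ℝ 1 (W t) x‖ₑ ^ 2 < ⊤) ∧ (∫⁻ x, ‖iteratedFDeriv ℝ 2 (W t) x‖ₑ ^ 2 < ⊤) ∧ ∃ M : ℝ, (∀ x, ‖(W t) x‖ ≤ M) ∧ 0 < M * Real.sqrt (∫ x, ‖Literature.Analysis.FluidPDE.curl (W t) x‖ ^ 2) * Real.sqrt (∫ x, Literature.Analysis.FluidPDE.frobeniusNormSq (fderiv ℝ (Literature.Analysis.FluidPDE.curl (W t)) x)) ∧ (sInf {κ : ℝ | (∀ (v : EuclideanSpace ℝ (Fin 3) → EuclideanSpace ℝ (Fin 3)) (M B : ℝ), ContDiff ℝ (⊤ : ℕ∞) v → Literature.Analysis.FluidPDE.VectorCalculus.IsDivFree v → (∀ x, ‖v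 x‖ ≤ M) → (∀ x, ‖fderiv ℝ v x‖ ≤ B) → (∫⁻ x, ‖iteratedFDeriv ℝ 0 v x‖ₑ ^ 2 < ⊤) → (∫⁻ x, ‖iteratedFDeriv ℝ 1 v x‖ₑ ^ 2 < ⊤) → (∫⁻ x, ‖iteratedFDeriv ℝ 2 v x‖ₑ ^ 2 < ⊤) → |∫ x, ⟪Literature.Analysis.FluidPDE.curl v x, fderiv ℝ v x (Literature.Analysis.FluidPDE.curl v x)⟫_ℝ| ≤ κ * M * Real.sqrt (∫ x, ‖Literature.Analysis.FluidPDE.curl v x‖ ^ 2) * Real.sqrt (∫ x, Literature.Analysis.FluidPDE.frobeniusNormSq (fderiv ℝ (Literature.Analysis.FluidPDE.curl v) x)))}) * M * Real.sqrt (∫ x, ‖Literature.Analysis.FluidPDE.curl (W t) x‖ ^ 2) * Real.sqrt (∫ x, Literature.Analysis.FluidPDE.frobeniusNormSq (fderiv ℝ (Literature.Analysis.FluidPDE.curl (W t)) x)) ≤ |∫ x, ⟪Literature.Analysis.FluidPDE.curl (W t) x, fderiv ℝ (W t) x (Literature.Analysis.FluidPDE.curl (W t) x)⟫_ℝ|)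 := by
    by_contra hno
    have hsub : Set.Ioo a b ⊆ {t : ℝ | ¬ (t ∈ Set.Ioo a b → (ContDiff ℝ (⊤ : ℕ∞) (W t) ∧ Literature.Analysis.FluidPDE.VectorCalculus.IsDivFree (W t) ∧ (∃ B : ℝ, ∀ x, ‖fderiv ℝ (W t) x‖ ≤ B) ∧ (∫⁻ x, ‖iteratedFDeriv ℝ 1 (W t) x‖ₑ ^ 2 < ⊤) ∧ (∫⁻ x, ‖iteratedFDeriv ℝ 2 (W t) x‖ₑ ^ 2 < ⊤) ∧ ∃ M : ℝ, (∀ x, ‖(W t) x‖ ≤ M) ∧ 0 < M * Real.sqrt (∫ x, ‖Literature.Analysis.FluidPDE.curl (W t) x‖ ^ 2) * Real.sqrt (∫ x, Literature.Analysis.FluidPDE.frobeniusNormSq (fderiv ℝ (Literature.Analysis.FluidPDE.curl (W t)) x)) ∧ (sInf {κ : ℝ | (∀ (v : EuclideanSpace ℝ (Fin 3) → EuclideanSpace ℝ (Fin 3)) (M B : ℝ), ContDiff ℝ (⊤ : ℕ∞) v → Literature.Analysis.FluidPDE.VectorCalculus.IsDivFree v → (∀ x, ‖v x‖ ≤ M)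 → (∀ x, ‖fderiv ℝ v x‖ ≤ B) → (∫⁻ x, ‖iteratedFDeriv ℝ 0 v x‖ₑ ^ 2 < ⊤) → (∫⁻ x, ‖iteratedFDeriv ℝ 1 v x‖ₑ ^ 2 < ⊤) → (∫⁻ x, ‖iteratedFDeriv ℝ 2 v x‖ₑ ^ 2 < ⊤) → |∫ x, ⟪Literature.Analysis.FluidPDE.curl v x, fderiv ℝ v x (Literature.Analysis.FluidPDE.curl v x)⟫_ℝ| ≤ κ * M * Real.sqrt (∫ x, ‖Literature.Analysis.FluidPDE.curl v x‖ ^ 2) * Real.sqrt (∫ x, Literature.Analysis.FluidPDE.frobeniusNormSq (fderiv ℝ (Literature.Analysis.FluidPDE.curl v) x)))}) * M * Real.sqrt (∫ x, ‖Literature.Analysis.FluidPDE.curl (W t) x‖ ^ 2) * Real.sqrt (∫ x, Literature.Analysis.FluidPDE.frobeniusNormSq (fderiv ℝ (Literature.Analysis.FluidPDE.curl (W t)) x)) ≤ |∫ x, ⟪Literature.Analysis.FluidPDE.curl (W t) x, fderiv ℝ (W t) x (Literature.Analysis.FluidPDE.curl (W t) x)⟫_ℝ|))} :=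
      fun t ht himp => hno ⟨t, ht, himp ht⟩
    have h0 : volume (Set.Ioo a b) = 0 := measure_mono_null hsub (ae_iff.mp hae)
    rw [Real.volume_Ioo, ENNReal.ofReal_eq_zero] at h0
    linarith
  obtain ⟨t, ht, hcd, hdiv, ⟨B, hB⟩, h1, h2, M, hM, hpos, hext⟩ := hex
  have ht0 : t < 0 := lt_of_lt_of_le ht.2 hb0
  -- joint continuity on (−∞,0) × ℝ³ from KNSS smoothness
  have hcont : ContinuousOn (Function.uncurry W) (Set.Iio (0 : ℝ) ×ˢ Set.univ) := hW.1.smooth.continuousOn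
  -- Type-I decay in `HasTypeITimeDecay` form
  have hT : Literature.Analysis.FluidPDE.HasTypeITimeDecay K W := by
    intro s hs x
    have hst : 0 < Real.sqrt (-s) := Real.sqrt_pos.2 (by linarith)
    rw [le_div_iff₀ hst, mul_comm]
    exact hdec s hs x
  -- the Oseen–Duhamel identity in `heatExtension` form
  have hmild' : ∀ s t : ℝ, s < t → t < 0 → ∀ x,
      W t x = Literature.Analysis.UnboundedOperators.heatExtension (W s) (t - s) x - Literature.Analysis.FluidPDE.oseenDuhamel 1 s W W t x := by
    intro s t hst ht' x
    rw [← Literature.Analysis.FluidPDE.heatFlow_of_pos (W s) (by linarith : 0 < t - s)]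
    exact hW.2 s t hst ht' x
  -- the extremal slice is real-analytic
  have han : AnalyticOnNhd ℝ (W t) Set.univ :=
    PoloidalWindowDoorPoloidalWindowRigidityTypeIAnalytic.typeI_mild_slice_analytic K W hT hcont hmild' t ht0
  -- equality in the extended sharp inequality, hence constant speed
  have hle := ExtremiserLiouville.extendedSharp (W t) M B hcd hdiv hM hB h1 h2
  have hatt := le_antisymm hle hext
  have hcs : ∀ x, ‖W t x‖ = M :=
    ExtremiserLiouville.norm_eq_of_analytic_extremal hcd han hdiv hM hB h1 h2 hpos hatt
  -- M > 0 and the plateau is all of ℝ³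
  have hM0 : 0 < M := by
    by_contra hle0
    push Not at hle0
    have hzw : 0 ≤ Real.sqrt (∫ x, ‖Literature.Analysis.FluidPDE.curl (W t) x‖ ^ 2) *
        Real.sqrt (∫ x, Literature.Analysis.FluidPDE.frobeniusNormSq (fderiv ℝ (Literature.Analysis.FluidPDE.curl (W t)) x)) :=
      mul_nonneg (Real.sqrt_nonneg _) (Real.sqrt_nonneg _)
    have hnp : M * Real.sqrt (∫ x, ‖Literature.Analysis.FluidPDE.curl (W t) x‖ ^ 2) *
        Real.sqrt (∫ x, Literature.Analysis.FluidPDE.frobeniusNormSq (fderiv ℝ (Literature.Analysis.FluidPDE.curl (W t)) x)) ≤ 0 := by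
      rw [mul_assoc]
      exact mul_nonpos_iff.2 (Or.inr ⟨hle0, hzw⟩)
    exact absurd hpos (not_lt.2 hnp)
  have hvol : 0 < MeasureTheory.volume {y : EuclideanSpace ℝ (Fin 3) | ‖W t y‖ = M} := by
    have hset : {y : EuclideanSpace ℝ (Fin 3) | ‖W t y‖ = M} = Set.univ := Set.eq_univ_of_forall fun y => hcs y
    rw [hset]
    exact isOpen_univ.measure_pos _ Set.univ_nonempty
  exact plateauSliceRigidity ⟨W, K, t, M, hcont, hW.2, hdec, ht0, hM0, hM, hvol⟩

/-- **COROLLARY, curried (critic V89 P2 — consumable by name).**  K2's conclusion — an extremal KNSS ancient mild solution, a.e.-extremal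
on a time interval `(a, b)`, `b ≤ 0` — is contradictory as soon as the ancient solution has Type-I decay `√(−t)‖W t x‖ ≤ K`, for ANY `K`.
This is `noExtremalAncient_of_typeI` with the existential opened, for users of `ExtremiserTransience.NoExtremalAncient` (item 26569) on
fixed-`C` branches (26567 via 26568/27696; 27677), where the K2-type compactness step can carry the rate into the limit.  Sorry-free. -/
theorem false_of_extremalAncient_typeI (W : ℝ → EuclideanSpace ℝ (Fin 3) → EuclideanSpace ℝ (Fin 3)) (a b K : ℝ)
    (hW : Literature.Analysis.FluidPDE.IsKNSSBlowupLimit W ∧ (∀ s t : ℝ, s < t → t < 0 → ∀ x, W t x = Literature.Analysis.FluidPDE.heatFlow (W s) (t - s) x - Literature.Analysis.FluidPDE.oseenDuhamel 1 s W W t x))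
    (hdec : ∀ t : ℝ, t < 0 → ∀ x, Real.sqrt (-t) * ‖W t x‖ ≤ K) (hab : a < b) (hb0 : b ≤ 0)
    (hae : ∀ᵐ t : ℝ, t ∈ Set.Ioo a b → (ContDiff ℝ (⊤ : ℕ∞) (W t) ∧ Literature.Analysis.FluidPDE.VectorCalculus.IsDivFree (W t) ∧ (∃ B : ℝ, ∀ x, ‖fderiv ℝ (W t) x‖ ≤ B) ∧ (∫⁻ x, ‖iteratedFDeriv ℝ 1 (W t) x‖ₑ ^ 2 < ⊤) ∧ (∫⁻ x, ‖iteratedFDeriv ℝ 2 (W t) x‖ₑ ^ 2 < ⊤) ∧ ∃ M : ℝ, (∀ x, ‖(W t) x‖ ≤ M) ∧ 0 < M * Real.sqrt (∫ x, ‖Literature.Analysis.FluidPDE.curl (W t) x‖ ^ 2) * Real.sqrt (∫ x, Literature.Analysis.FluidPDE.frobeniusNormSq (fderiv ℝ (Literature.Analysis.FluidPDE.curl (W t)) x)) ∧ (sInf {κ : ℝ | (∀ (v : EuclideanSpace ℝ (Fin 3) → EuclideanSpace ℝ (Fin 3)) (M B : ℝ), ContDiff ℝ (⊤ : ℕ∞)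 v → Literature.Analysis.FluidPDE.VectorCalculus.IsDivFree v → (∀ x, ‖v x‖ ≤ M) → (∀ x, ‖fderiv ℝ v x‖ ≤ B) → (∫⁻ x, ‖iteratedFDeriv ℝ 0 v x‖ₑ ^ 2 < ⊤) → (∫⁻ x, ‖iteratedFDeriv ℝ 1 v x‖ₑ ^ 2 < ⊤) → (∫⁻ x, ‖iteratedFDeriv ℝ 2 v x‖ₑ ^ 2 < ⊤) → |∫ x, ⟪Literature.Analysis.FluidPDE.curl v x, fderiv ℝ v x (Literature.Analysis.FluidPDE.curl v x)⟫_ℝ| ≤ κ * M * Real.sqrt (∫ x, ‖Literature.Analysis.FluidPDE.curl v x‖ ^ 2) * Real.sqrt (∫ x, Literature.Analysis.FluidPDE.frobeniusNormSq (fderiv ℝ (Literature.Analysis.FluidPDE.curl v) x)))}) * M * Real.sqrt (∫ x, ‖Literature.Analysis.FluidPDE.curl (W t) x‖ ^ 2) * Real.sqrt (∫ x, Literature.Analysis.FluidPDE.frobeniusNormSq (fderiv ℝ (Literature.Analysis.FluidPDE.curl (W t)) x)) ≤ |∫ x, ⟪Literature.Analysis.FluidPDE.curl (W t) x, fderiv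 ℝ (W t) x (Literature.Analysis.FluidPDE.curl (W t) x)⟫_ℝ|)) : False :=
  noExtremalAncient_of_typeI ⟨W, a, b, K, hW, hdec, hab, hb0, hae⟩

/-- **COMPOSITION (kernel-checked): the two stubs ⇒ the crux `NearExtremalTransience` BY NAME.**  Persistence is refuted by
`stub_rateInheritance`, `stub_boundedRateExtremalLimit` and the PROVED `noExtremalAncient_of_typeI`; the rest is line B's
persistence bookkeeping verbatim (uniform level β, log-length L, blocks of log-length L, DSS log-mean tools). -/
theorem NearExtremalTransience_of :
    Summit.NavierStokesRegularity.NavierStokesRegularity.Theses.ExtremiserTransience.NearExtremalTransience := by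
  have hnotP : ¬ (∀ β : ℝ, β < (sInf {κ : ℝ | (∀ (v : EuclideanSpace ℝ (Fin 3) → EuclideanSpace ℝ (Fin 3)) (M B : ℝ), ContDiff ℝ (⊤ : ℕ∞) v → Literature.Analysis.FluidPDE.VectorCalculus.IsDivFree v → (∀ x, ‖v x‖ ≤ M) → (∀ x, ‖fderiv ℝ v x‖ ≤ B) → (∫⁻ x, ‖iteratedFDeriv ℝ 0 v x‖ₑ ^ 2 < ⊤) → (∫⁻ x, ‖iteratedFDeriv ℝ 1 v x‖ₑ ^ 2 < ⊤) → (∫⁻ x, ‖iteratedFDeriv ℝ 2 v x‖ₑ ^ 2 < ⊤) → |∫ x, ⟪Literature.Analysis.FluidPDE.curl v x, fderiv ℝ v x (Literature.Analysis.FluidPDE.curl v x)⟫_ℝ| ≤ κ * M * Real.sqrt (∫ x, ‖Literature.Analysis.FluidPDE.curl v x‖ ^ 2) * Real.sqrt (∫ x, Literature.Analysis.FluidPDE.frobeniusNormSq (fderiv ℝ (Literature.Analysis.FluidPDE.curl v) x)))}) ^ 2 → ∀ L : ℝ, 0 < L → ∃ (C ν T : ℝ) (u : ℝ → EuclideanSpace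 ℝ (Fin 3) → EuclideanSpace ℝ (Fin 3)) (p : ℝ → EuclideanSpace ℝ (Fin 3) → ℝ), 0 < C ∧ 0 < ν ∧ 0 < T ∧ Literature.Analysis.FluidPDE.IsClassicalNSSolutionOn (Set.Ico 0 T) ν 0 u p ∧ Literature.Analysis.FluidPDE.IsLerayHopfOn T ν 0 (u 0) u ∧ Literature.Analysis.FluidPDE.HasRapidSpatialDecay (u 0) ∧ (∀ᶠ t in 𝓝[<] T, ∀ x, Real.sqrt (T - t) * ‖u t x‖ ≤ C * Real.sqrt ν) ∧ ¬ Literature.Analysis.FluidPDE.HasSmoothExtensionPast ν 0 u T ∧ ∀ (k : ℝ → ℝ), Measurable k → (∀ τ, 0 ≤ k τ ∧ k τ ≤ 1) → (∀ t ∈ Set.Ico 0 T, ∀ M : ℝ, (∀ x, ‖u t x‖ ≤ M) → |∫ x, ⟪Literature.Analysis.FluidPDE.curl (u t) x, fderiv ℝ (u t) x (Literature.Analysis.FluidPDE.curl (u t) x)⟫_ℝ| ≤ k t * M * Real.sqrt (∫ x, ‖Literature.Analysis.FluidPDE.curl (u t) x‖ ^ 2) * Real.sqrt (∫ x, Literature.Analysis.FluidPDE.frobeniusNormSq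 (fderiv ℝ (Literature.Analysis.FluidPDE.curl (u t)) x))) → ∀ t₁ ∈ Set.Ico 0 T, ∃ s₁ s₂ : ℝ, t₁ ≤ s₁ ∧ s₁ < s₂ ∧ s₂ < T ∧ L ≤ Real.log ((T - s₁) / (T - s₂)) ∧ β * Real.log ((T - s₁) / (T - s₂)) < ∫ τ in s₁..s₂, k τ ^ 2 / (T - τ)) := fun hP =>
    noExtremalAncient_of_typeI (stub_boundedRateExtremalLimit (stub_rateInheritance hP))
  -- Step 1: the uniform level β < κ⋆² and log-length L > 0.
  obtain ⟨β, hβ⟩ := not_forall.mp hnotP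
  obtain ⟨hβlt, hβ2⟩ := Classical.not_imp.mp hβ
  obtain ⟨L, hL⟩ := not_forall.mp hβ2
  obtain ⟨hLpos, hrest⟩ := Classical.not_imp.mp hL
  -- constants of the sharp-constant API
  have hκgt : (13 : ℝ) / 200 < sInf {κ : ℝ | (∀ (v : EuclideanSpace ℝ (Fin 3) → EuclideanSpace ℝ (Fin 3)) (M B : ℝ), ContDiff ℝ (⊤ : ℕ∞) v → Literature.Analysis.FluidPDE.VectorCalculus.IsDivFree v → (∀ x, ‖v x‖ ≤ M) → (∀ x, ‖fderiv ℝ v x‖ ≤ B) → (∫⁻ x, ‖iteratedFDeriv ℝ 0 v x‖ₑ ^ 2 < ⊤) → (∫⁻ x, ‖iteratedFDeriv ℝ 1 v x‖ₑ ^ 2 < ⊤) → (∫⁻ x, ‖iteratedFDeriv ℝ 2 v x‖ₑ ^ 2 < ⊤) → |∫ x, ⟪Literature.Analysis.FluidPDE.curl v x, fderiv ℝ v x (Literature.Analysis.FluidPDE.curl v x)⟫_ℝ| ≤ κ * M * Real.sqrt (∫ x, ‖Literature.Analysis.FluidPDE.curl v x‖ ^ 2) * Real.sqrt (∫ x, Literature.Analysis.FluidPDE.frobeniusNormSq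 (fderiv ℝ (Literature.Analysis.FluidPDE.curl v) x)))} := sharpDepletion_gt
  have hκpos : (0 : ℝ) < sInf {κ : ℝ | (∀ (v : EuclideanSpace ℝ (Fin 3) → EuclideanSpace ℝ (Fin 3)) (M B : ℝ), ContDiff ℝ (⊤ : ℕ∞) v → Literature.Analysis.FluidPDE.VectorCalculus.IsDivFree v → (∀ x, ‖v x‖ ≤ M) → (∀ x, ‖fderiv ℝ v x‖ ≤ B) → (∫⁻ x, ‖iteratedFDeriv ℝ 0 v x‖ₑ ^ 2 < ⊤) → (∫⁻ x, ‖iteratedFDeriv ℝ 1 v x‖ₑ ^ 2 < ⊤) → (∫⁻ x, ‖iteratedFDeriv ℝ 2 v x‖ₑ ^ 2 < ⊤) → |∫ x, ⟪Literature.Analysis.FluidPDE.curl v x, fderiv ℝ v x (Literature.Analysis.FluidPDE.curl v x)⟫_ℝ| ≤ κ * M * Real.sqrt (∫ x, ‖Literature.Analysis.FluidPDE.curl v x‖ ^ 2) * Real.sqrt (∫ x, Literature.Analysis.FluidPDE.frobeniusNormSq (fderiv ℝ (Literature.Analysis.FluidPDE.curl v) x)))} := lt_trans (by norm_num) hκ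gt
  have hm0 : (0 : ℝ) ≤ max β 0 := le_max_right _ _
  have hA0 : (0 : ℝ) ≤ max β 0 * L := mul_nonneg hm0 hLpos.le
  refine ⟨Real.sqrt (max β 0) / sInf {κ : ℝ | (∀ (v : EuclideanSpace ℝ (Fin 3) → EuclideanSpace ℝ (Fin 3)) (M B : ℝ), ContDiff ℝ (⊤ : ℕ∞) v → Literature.Analysis.FluidPDE.VectorCalculus.IsDivFree v → (∀ x, ‖v x‖ ≤ M) → (∀ x, ‖fderiv ℝ v x‖ ≤ B) → (∫⁻ x, ‖iteratedFDeriv ℝ 0 v x‖ₑ ^ 2 < ⊤) → (∫⁻ x, ‖iteratedFDeriv ℝ 1 v x‖ₑ ^ 2 < ⊤) → (∫⁻ x, ‖iteratedFDeriv ℝ 2 v x‖ₑ ^ 2 < ⊤) → |∫ x, ⟪Literature.Analysis.FluidPDE.curl v x, fderiv ℝ v x (Literature.Analysis.FluidPDE.curl v x)⟫_ℝ| ≤ κ * M * Real.sqrt (∫ x, ‖Literature.Analysis.FluidPDE.curl v x‖ ^ 2) * Real.sqrt (∫ x, Literature.Analysis.FluidPDE.frobeniusNormSq (fderiv ℝ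 (Literature.Analysis.FluidPDE.curl v) x)))}, div_nonneg (Real.sqrt_nonneg _) hκpos.le, ?_, ?_⟩
  · rw [div_lt_one hκpos, Real.sqrt_lt' hκpos]
    exact max_lt hβlt (by positivity)
  intro κ hκ C ν T hC hν hT u p hcl hLH hdec hrate hsing
  have hκle : sInf {κ : ℝ | (∀ (v : EuclideanSpace ℝ (Fin 3) → EuclideanSpace ℝ (Fin 3)) (M B : ℝ), ContDiff ℝ (⊤ : ℕ∞) v → Literature.Analysis.FluidPDE.VectorCalculus.IsDivFree v → (∀ x, ‖v x‖ ≤ M) → (∀ x, ‖fderiv ℝ v x‖ ≤ B) → (∫⁻ x, ‖iteratedFDeriv ℝ 0 v x‖ₑ ^ 2 < ⊤) → (∫⁻ x, ‖iteratedFDeriv ℝ 1 v x‖ₑ ^ 2 < ⊤) → (∫⁻ x, ‖iteratedFDeriv ℝ 2 v x‖ₑ ^ 2 < ⊤) → |∫ x, ⟪Literature.Analysis.FluidPDE.curl v x, fderiv ℝ v x (Literature.Analysis.FluidPDE.curl v x)⟫_ℝ| ≤ κ * M * Real.sqrt (∫ x, ‖Literature.Analysis.FluidPDE.curl v x‖ ^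 2) * Real.sqrt (∫ x, Literature.Analysis.FluidPDE.frobeniusNormSq (fderiv ℝ (Literature.Analysis.FluidPDE.curl v) x)))} ≤ κ := sharpDepletion_le hκ
  -- Step 2: along this flow, some admissible coefficient k and onset t₁ have only subextremal long windows.
  have hk : ¬ (∀ (k : ℝ → ℝ), Measurable k → (∀ τ, 0 ≤ k τ ∧ k τ ≤ 1) → (∀ t ∈ Set.Ico 0 T, ∀ M : ℝ, (∀ x, ‖u t x‖ ≤ M) → |∫ x, ⟪Literature.Analysis.FluidPDE.curl (u t) x, fderiv ℝ (u t) x (Literature.Analysis.FluidPDE.curl (u t) x)⟫_ℝ| ≤ k t * M * Real.sqrt (∫ x, ‖Literature.Analysis.FluidPDE.curl (u t) x‖ ^ 2) * Real.sqrt (∫ x, Literature.Analysis.FluidPDE.frobeniusNormSq (fderiv ℝ (Literature.Analysis.FluidPDE.curl (u t)) x))) → ∀ t₁ ∈ Set.Ico 0 T, ∃ s₁ s₂ : ℝ, t₁ ≤ s₁ ∧ s₁ < s₂ ∧ s₂ < T ∧ L ≤ Real.log ((T - s₁) / (T - s₂)) ∧ β * Real.log ((T - s₁) / (T - s₂)) <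 ∫ τ in s₁..s₂, k τ ^ 2 / (T - τ)) := fun hall =>
    hrest ⟨C, ν, T, u, p, hC, hν, hT, hcl, hLH, hdec, hrate, hsing, hall⟩
  obtain ⟨k, hk1⟩ := not_forall.mp hk
  obtain ⟨hkm, hk2⟩ := Classical.not_imp.mp hk1
  obtain ⟨hk01, hk3⟩ := Classical.not_imp.mp hk2
  obtain ⟨hclause, hk4⟩ := Classical.not_imp.mp hk3
  obtain ⟨t₁, ht₁'⟩ := not_forall.mp hk4
  obtain ⟨ht₁, hnowin⟩ := Classical.not_imp.mp ht₁'
  have hwin : ∀ s₁ s₂ : ℝ, t₁ ≤ s₁ → s₁ < s₂ → s₂ < T → L ≤ Real.log ((T - s₁) / (T - s₂)) →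
      ∫ τ in s₁..s₂, k τ ^ 2 / (T - τ) ≤ β * Real.log ((T - s₁) / (T - s₂)) :=
    fun s₁ s₂ h1 h2 h3 h4 => not_lt.mp fun hlt => hnowin ⟨s₁, s₂, h1, h2, h3, h4, hlt⟩
  have hTt₁ : 0 < T - t₁ := sub_pos.mpr ht₁.2
  -- Step 3: geometric blocks of log-length exactly L carry mass ≤ max β 0 · L.
  have hblock : ∀ n : ℕ, ∫ τ in (T - (T - t₁) * Real.exp (-(n * L)))..(T - (T - t₁) * Real.exp (-((n + 1) * L))), k τ ^ 2 / (T - τ) ≤ max β 0 * L := by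
    intro n
    have hn : (0 : ℝ) ≤ n := n.cast_nonneg
    have he1 : Real.exp (-(n * L)) ≤ 1 := by
      rw [Real.exp_le_one_iff]
      have := mul_nonneg hn hLpos.le
      linarith
    have he2 : Real.exp (-((n + 1) * L)) < Real.exp (-(n * L)) := by
      rw [Real.exp_lt_exp]
      have : ((n : ℝ) + 1) * L = n * L + L := by ring
      rw [this]
      linarith
    have h1 : t₁ ≤ (T - (T - t₁) * Real.exp (-(n * L))) := by
      have := mul_le_mul_of_nonneg_left he1 hTt₁.le
      linarith
    have h2 : (T - (T - t₁) * Real.exp (-(n * L))) < (T - (T - t₁) * Real.exp (-((n + 1) * L))) := by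
      have := mul_lt_mul_of_pos_left he2 hTt₁
      linarith
    have h3 : (T - (T - t₁) * Real.exp (-((n + 1) * L))) < T := by
      have := mul_pos hTt₁ (Real.exp_pos (-((n + 1) * L)))
      linarith
    have hratio : (T - (T - (T - t₁) * Real.exp (-(n * L)))) / (T - (T - (T - t₁) * Real.exp (-((n + 1) * L)))) = Real.exp L := by
      rw [show T - (T - (T - t₁) * Real.exp (-(n * L))) = (T - t₁) * Real.exp (-(n * L)) by ring,
        show T - (T - (T - t₁) * Real.exp (-((n + 1) * L))) = (T - t₁) * Real.exp (-((n + 1) * L)) by ring,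
        mul_div_mul_left _ _ hTt₁.ne', ← Real.exp_sub]
      congr 1
      ring
    have hlog : Real.log ((T - (T - (T - t₁) * Real.exp (-(n * L)))) / (T - (T - (T - t₁) * Real.exp (-((n + 1) * L))))) = L := by
      rw [hratio, Real.log_exp]
    have hw := hwin (T - (T - t₁) * Real.exp (-(n * L))) (T - (T - t₁) * Real.exp (-((n + 1) * L))) h1 h2 h3 (le_of_eq hlog.symm)
    rw [hlog] at hw
    exact hw.trans (mul_le_mul_of_nonneg_right (le_max_left _ _) hLpos.le)
  -- Step 4: sum the blocks (tree lemma) and restrict the flow-wise clause to [t₁, T).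
  have hmain := blocksToLog_general (g := fun τ => k τ ^ 2 / (T - τ)) (t₁ := t₁) (T := T) (A := max β 0 * L) (ℓ := L)
    ht₁.2 hA0 hLpos (fun τ hτ => div_nonneg (sq_nonneg _) (sub_nonneg.mpr (le_of_lt hτ.2)))
    (fun t ht => intervalIntegrable_coeff_sq_div hkm hk01 ht.1 ht.2) hblock
  refine ⟨t₁, ht₁, k, max β 0 * L, hkm, hk01, fun t ht M hM => hclause t ⟨ht₁.1.trans ht.1, ht.2⟩ M hM, fun t ht => ?_⟩
  have h := hmain t ht
  have hlog0 : 0 ≤ Real.log ((T - t₁) / (T - t)) := by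
    apply Real.log_nonneg
    rw [le_div_iff₀ (sub_pos.mpr ht.2)]
    linarith [ht.1]
  have hcoef : max β 0 * L / L ≤ (Real.sqrt (max β 0) / sInf {κ : ℝ | (∀ (v : EuclideanSpace ℝ (Fin 3) → EuclideanSpace ℝ (Fin 3)) (M B : ℝ), ContDiff ℝ (⊤ : ℕ∞) v → Literature.Analysis.FluidPDE.VectorCalculus.IsDivFree v → (∀ x, ‖v x‖ ≤ M) → (∀ x, ‖fderiv ℝ v x‖ ≤ B) → (∫⁻ x, ‖iteratedFDeriv ℝ 0 v x‖ₑ ^ 2 < ⊤) → (∫⁻ x, ‖iteratedFDeriv ℝ 1 v x‖ₑ ^ 2 < ⊤) → (∫⁻ x, ‖iteratedFDeriv ℝ 2 v x‖ₑ ^ 2 < ⊤) → |∫ x, ⟪Literature.Analysis.FluidPDE.curl v x, fderiv ℝ v x (Literature.Analysis.FluidPDE.curl v x)⟫_ℝ| ≤ κ * M * Real.sqrt (∫ x, ‖Literature.Analysis.FluidPDE.curl v x‖ ^ 2) * Real.sqrt (∫ x, Literature.Analysis.FluidPDE.frobeniusNormSq (fderiv ℝ (Literature.Analysis.FluidPDE.curl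 v) x)))} * κ) ^ 2 := by
    rw [mul_div_assoc, div_self hLpos.ne', mul_one, div_mul_eq_mul_div, div_pow, mul_pow, Real.sq_sqrt hm0,
      le_div_iff₀ (pow_pos hκpos 2)]
    exact mul_le_mul_of_nonneg_left (pow_le_pow_left₀ hκpos.le hκle 2) hm0
  exact h.trans (add_le_add (mul_le_mul_of_nonneg_right hcoef hlog0) le_rfl)

-- audit: the composition concludes the crux BY NAME; sorries only in the two stubs; the splice theorem is sorry-free.
#print axioms NearExtremalTransience_of

#print axioms noExtremalAncient_of_typeI

end Summit.NavierStokesRegularity.NavierStokesRegularity.Cruxes.NearExtremalTransience.TypeOneSplice
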